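import Literature.Computability.AlgebraicComplexity.CommutativeExtensionSimulation
import Literature.Computability.AlgebraicComplexity.CircuitDepth
import Literature.Computability.AlgebraicComplexity.DepthReductionProofs
import Literature.Computability.AlgebraicComplexity.CircuitGateSemantics

/-!
# SuccinctLift — a depth-aware joint-computation toolkit (`JointPD`)

Route `route-ValiantsHypothesis-SuccinctLift` (Valiant decomposition workshop, lens 2), wall D
(`AlgDescentLog3`, stmt-ValiantsHypothesis-23721).  Bookkeeping for simulations of unbounded
fan-in arithmetic circuits (`ArithCircuit`, sum and product gates) that must control the PRODUCT
DEPTH as well as the edge size: the predicate `JointPD v δ s` says that ONE gate list of total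
fan-in `≤ s` computes every member `v i` of a family by a STABLE operand (its value and weighted
depth do not change when gates are appended) of product depth `≤ δ i`; cf. the size-only
`JointlyComputed` of `Literature/…/JointCircuits.lean`.  Lemmas: extraction of a circuit
(`JointPD.toCircuit`), inputs (`jointPD_of_inputs`), and the two block extensions used by the
power-basis simulation (`SuccinctLiftPowerBasisDescent.lean`): one LINEAR layer
(`JointPD.extend_sum`, depth `≤ D`, cost `#κ · #J`) and one PRODUCT layer (`JointPD.extend_prod`,
depth `≤ D + 1`).  Route-independent (no `Theses` import).

References: LimayeSrinivasanTavenas2021 (§2, product depth); Burgisser2000 (Def. 2.1, the model).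
-/

noncomputable section

open MvPolynomial

-- the summit and the problem share the name `ValiantsHypothesis` (D-0017 single-conjunct layout)
set_option linter.dupNamespace false

namespace Summit.ValiantsHypothesis.ValiantsHypothesis.Theorems.SuccinctLiftJointPD

open Literature.Computability.AlgebraicComplexity ArithCircuit

universe u v w

/-! ### List bookkeeping -/

section Toolkit

variable {k : Type u} [CommSemiring k] {τ : Type v}

omit [CommSemiring k] in
/-- Sum gates weigh `0` under the product-depth weight `ArithCircuit.prodWeight`.
[cite: LimayeSrinivasanTavenas2021, §2] -/
@[simp] theorem prodWeight_sum (l : List (k × Operand k τ)) : prodWeight (Gate.sum l) = 0 := rfl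

omit [CommSemiring k] in
/-- Product gates weigh `1` under `ArithCircuit.prodWeight`. [cite: LimayeSrinivasanTavenas2021, §2] -/
@[simp] theorem prodWeight_prod (l : List (Operand k τ)) : prodWeight (Gate.prod l) = 1 := rfl

/-- Appending gates whose values are stable over `G`: the value list grows by their values against
`gateValues G`. [cite: Burgisser2000, Def. 2.1] -/
theorem gateValues_append_of_stable (G L : List (Gate k τ))
    (hL : ∀ g ∈ L, ∀ ws, g.eval (gateValues G ++ ws) = g.eval (gateValues G)) :
    gateValues (G ++ L) = gateValues G ++ L.map (fun g => g.eval (gateValues G)) := by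
  induction L using List.reverseRecOn with
  | nil => simp
  | append_singleton L g ih =>
    rw [← List.append_assoc, gateValues_append_singleton,
      ih (fun g' hg' => hL g' (List.mem_append_left _ hg')), hL g (by simp) (L.map _),
      List.map_append, List.map_singleton, List.append_assoc]

omit [CommSemiring k] in
/-- Appending gates whose operand depths over `G` are bounded: the depth list grows by entries
bounded by `B`. [cite: LimayeSrinivasanTavenas2021, §2] -/
theorem gateWDepths_append_le (wt : Gate k τ → ℕ) (G L : List (Gate k τ)) (B : ℕ)
    (hL : ∀ g ∈ L, ∀ ds,
      wt g + ((g.args.map (Operand.depthIn (gateWDepths wt G ++ ds))).foldr max 0) ≤ B) :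
    ∃ Ds : List ℕ, gateWDepths wt (G ++ L) = gateWDepths wt G ++ Ds ∧ Ds.length = L.length ∧
      ∀ x ∈ Ds, x ≤ B := by
  induction L using List.reverseRecOn with
  | nil => exact ⟨[], by simp, rfl, fun x hx => by simp at hx⟩
  | append_singleton L g ih =>
    obtain ⟨Ds, hDs, hlen, hB⟩ := ih (fun g' hg' => hL g' (List.mem_append_left _ hg'))
    refine ⟨Ds ++ [wt g + ((g.args.map (Operand.depthIn (gateWDepths wt G ++ Ds))).foldr max 0)],
      ?_, by simp [hlen], ?_⟩
    · rw [← List.append_assoc, gateWDepths_append_singleton, hDs, List.append_assoc]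
    · intro x hx
      rcases List.mem_append.1 hx with hx | hx
      · exact hB x hx
      · rw [List.mem_singleton] at hx
        rw [hx]
        exact hL g (by simp) Ds

/-- **Depth-aware joint computation.** `JointPD v δ s`: there is ONE gate list of total fan-in
`≤ s` off which every member `v i` is read by a STABLE operand (correct whatever is appended later)
whose product-depth weight is `≤ δ i` (stably).  Depth-refined form of `JointlyComputed`
(Bürgisser 2000, Rem. 2.7: a straight-line program computes all its intermediate results).
[cite: Burgisser2000, Rem. 2.7] -/
def JointPD {ι : Type w} (v : ι → MvPolynomial τ k) (δ : ι → ℕ) (s : ℕ) : Prop :=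
  ∃ G : List (Gate k τ), (G.map Gate.fanIn).sum ≤ s ∧
    ∀ i, ∃ o : Operand k τ, (∀ ws, o.eval (gateValues G ++ ws) = v i) ∧
      ∀ ds, o.depthIn (gateWDepths prodWeight G ++ ds) ≤ δ i

/-- Read a member off as a circuit: it computes `v i` with product depth `≤ δ i` and edge size
`≤ s`. [cite: Burgisser2000, Rem. 2.7] -/
theorem JointPD.toCircuit {ι : Type w} {v : ι → MvPolynomial τ k} {δ : ι → ℕ} {s : ℕ}
    (h : JointPD v δ s) (i : ι) :
    ∃ P : ArithCircuit k τ, P.Computes (v i) ∧ P.productDepth ≤ δ i ∧ P.edgeSize ≤ s := by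
  obtain ⟨G, hs, hG⟩ := h
  obtain ⟨o, ho, hd⟩ := hG i
  refine ⟨⟨G, o⟩, ?_, ?_, hs⟩
  · have := ho []
    rwa [List.append_nil] at this
  · have := hd []
    rwa [List.append_nil] at this

/-- Re-indexing, sub-families, weakening of the bounds, and adjoining variables and constants are
free. [cite: Burgisser2000, Rem. 2.7] -/
theorem JointPD.reindex {ι : Type w} {ι' : Type*} {v : ι → MvPolynomial τ k} {δ : ι → ℕ}
    {s s' : ℕ} (h : JointPD v δ s) (w' : ι' → MvPolynomial τ k) (δ' : ι' → ℕ) (hs : s ≤ s')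
    (hw : ∀ i', (∃ i, w' i' = v i ∧ δ i ≤ δ' i') ∨ (∃ x, w' i' = X x) ∨ ∃ c, w' i' = C c) :
    JointPD w' δ' s' := by
  obtain ⟨G, hG, hmem⟩ := h
  refine ⟨G, hG.trans hs, fun i' => ?_⟩
  rcases hw i' with ⟨i, hi, hδ⟩ | ⟨x, hx⟩ | ⟨c, hc⟩
  · obtain ⟨o, ho, hd⟩ := hmem i
    exact ⟨o, fun ws => by rw [ho ws, hi], fun ds => (hd ds).trans hδ⟩
  · exact ⟨Operand.var x, fun ws => by rw [hx]; rfl, fun ds => Nat.zero_le _⟩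
  · exact ⟨Operand.const c, fun ws => by rw [hc]; rfl, fun ds => Nat.zero_le _⟩

/-- Inputs are free: a family of variables and constants is jointly computed by the empty gate
list. [cite: Burgisser2000, Rem. 2.7] -/
theorem jointPD_of_inputs {ι : Type w} (w' : ι → MvPolynomial τ k) (δ : ι → ℕ) (s : ℕ)
    (hw : ∀ i, (∃ x, w' i = X x) ∨ ∃ c, w' i = C c) : JointPD w' δ s := by
  refine ⟨[], by simp, fun i => ?_⟩
  rcases hw i with ⟨x, hx⟩ | ⟨c, hc⟩
  · exact ⟨Operand.var x, fun ws => by rw [hx]; rfl, fun ds => Nat.zero_le _⟩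
  · exact ⟨Operand.const c, fun ws => by rw [hc]; rfl, fun ds => Nat.zero_le _⟩

/-- Values and depths of a block of new gates `gateOf x` (`x : κ`, laid out along
`Fintype.equivFin κ`) appended to `G`, each reading only stable operands over `G`: member `x` sits
at position `|G| + e x`, has the value of `gateOf x` against `gateValues G`, and depth `≤ B`.
[cite: Burgisser2000, Rem. 2.7] -/
theorem block_members {κ : Type*} [Fintype κ] (G : List (Gate k τ)) (gateOf : κ → Gate k τ)
    (B : ℕ) (hval : ∀ x ws, (gateOf x).eval (gateValues G ++ ws) = (gateOf x).eval (gateValues G))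
    (hdep : ∀ x ds,
      prodWeight (gateOf x) + (((gateOf x).args.map (Operand.depthIn (gateWDepths prodWeight G ++ ds))).foldr
        max 0) ≤ B) (x : κ) :
    (∀ ws, (Operand.gate (G.length + Fintype.equivFin κ x) : Operand k τ).eval
        (gateValues (G ++ List.ofFn (gateOf ∘ (Fintype.equivFin κ).symm)) ++ ws) =
        (gateOf x).eval (gateValues G)) ∧
    (∀ ds, (Operand.gate (G.length + Fintype.equivFin κ x) : Operand k τ).depthIn
        (gateWDepths prodWeight (G ++ List.ofFn (gateOf ∘ (Fintype.equivFin κ).symm)) ++ ds) ≤ B) := by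
  set e := Fintype.equivFin κ with he
  set L := List.ofFn (gateOf ∘ e.symm) with hLdef
  have hmemL : ∀ g ∈ L, ∃ y, gateOf y = g := by
    intro g hg
    rw [hLdef, List.mem_ofFn] at hg
    obtain ⟨j, rfl⟩ := hg
    exact ⟨e.symm j, rfl⟩
  constructor
  · intro ws
    have hV := gateValues_append_of_stable G L (fun g hg ws => by
      obtain ⟨y, rfl⟩ := hmemL g hg
      exact hval y ws)
    show (gateValues (G ++ L) ++ ws).getD (G.length + e x) 0 = _
    rw [hV, List.append_assoc, List.getD_append_right _ _ _ _ (by simp),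
      gateValues_length, Nat.add_sub_cancel_left, List.getD_append _ _ _ _ (by simp [hLdef]),
      List.getD_eq_getElem?_getD, hLdef, List.map_ofFn, List.getElem?_ofFn]
    simp
  · intro ds
    obtain ⟨Ds, hDs, hlen, hB⟩ := gateWDepths_append_le prodWeight G L B (fun g hg ds => by
      obtain ⟨y, rfl⟩ := hmemL g hg
      exact hdep y ds)
    show (gateWDepths prodWeight (G ++ L) ++ ds).getD (G.length + e x) 0 ≤ B
    have hx : (e x : ℕ) < Ds.length := by rw [hlen, hLdef, List.length_ofFn]; exact (e x).isLt
    rw [hDs, List.append_assoc, List.getD_append_right _ _ _ _ (by simp [gateWDepths_length]),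
      gateWDepths_length, Nat.add_sub_cancel_left, List.getD_append _ _ _ _ hx,
      List.getD_eq_getElem?_getD, List.getElem?_eq_getElem hx, Option.getD_some]
    exact hB _ (List.getElem_mem hx)

/-- **One linear layer.** Appending, for each `x : κ`, ONE sum gate `∑_j a x j • v (src x j)`
reading members: cost `|κ| · |J|` wires, product depth `≤ D` if all the members read have depth
`≤ D`. [cite: Burgisser2000, Rem. 2.7] -/
theorem JointPD.extend_sum {ι : Type w} {v : ι → MvPolynomial τ k} {δ : ι → ℕ} {s : ℕ}
    (h : JointPD v δ s) {κ : Type*} [Fintype κ] {J : Type*} [Fintype J]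
    (a : κ → J → k) (src : κ → J → ι) (D : ℕ) (hD : ∀ x j, δ (src x j) ≤ D) :
    JointPD (Sum.elim v (fun x => ∑ j, a x j • v (src x j))) (Sum.elim δ (fun _ => D))
      (s + Fintype.card κ * Fintype.card J) := by
  classical
  obtain ⟨G, hG, hmem⟩ := h
  choose o ho hd using hmem
  have ho0 : ∀ i, (o i).eval (gateValues G) = v i := fun i => by
    simpa using ho i []
  set eJ := (Fintype.equivFin J).symm with heJ
  let gateOf : κ → Gate k τ := fun x =>
    Gate.sum (List.ofFn fun j : Fin (Fintype.card J) => (a x (eJ j), o (src x (eJ j))))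
  have hgval : ∀ x vals, (∀ i, (o i).eval vals = v i) →
      (gateOf x).eval vals = ∑ j, a x j • v (src x j) := by
    intro x vals hv
    simp only [gateOf, Gate.eval, List.map_ofFn, List.sum_ofFn, Function.comp_def, hv]
    exact Equiv.sum_comp eJ (fun j => a x j • v (src x j))
  have hval : ∀ x ws, (gateOf x).eval (gateValues G ++ ws) = (gateOf x).eval (gateValues G) := by
    intro x ws
    rw [hgval x _ (fun i => ho i ws), hgval x _ ho0]
  have hdep : ∀ x ds, prodWeight (gateOf x) +
      (((gateOf x).args.map (Operand.depthIn (gateWDepths prodWeight G ++ ds))).foldr max 0) ≤ D := by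
    intro x ds
    simp only [gateOf, prodWeight_sum, zero_add, Gate.args, List.map_ofFn]
    refine DepthReduction.foldr_max_le fun y hy => ?_
    rw [List.mem_ofFn] at hy
    obtain ⟨j, rfl⟩ := hy
    exact (hd _ ds).trans (hD _ _)
  have hB := block_members G gateOf D hval hdep
  refine ⟨G ++ List.ofFn (gateOf ∘ (Fintype.equivFin κ).symm), ?_, ?_⟩
  · rw [List.map_append, List.sum_append, List.map_ofFn, List.sum_ofFn]
    have : ∀ j : Fin (Fintype.card κ),
        (Gate.fanIn ∘ gateOf ∘ (Fintype.equivFin κ).symm) j = Fintype.card J := by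
      intro j
      simp [gateOf, Gate.fanIn, Gate.args, List.length_ofFn]
    simp only [this, Finset.sum_const, Finset.card_univ, Fintype.card_fin, smul_eq_mul]
    omega
  · rintro (i | x)
    · refine ⟨o i, fun ws => ?_, fun ds => ?_⟩
      · rw [Sum.elim_inl, gateValues_append_of_stable G _ (fun g hg ws => ?_), List.append_assoc,
          ho]
        rw [List.mem_ofFn] at hg
        obtain ⟨j, rfl⟩ := hg
        exact hval _ ws
      · obtain ⟨Ds, hDs, -, -⟩ := gateWDepths_append_le prodWeight G
          (List.ofFn (gateOf ∘ (Fintype.equivFin κ).symm)) D (fun g hg ds => by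
            rw [List.mem_ofFn] at hg
            obtain ⟨j, rfl⟩ := hg
            exact hdep _ ds)
        rw [Sum.elim_inl, hDs, List.append_assoc]
        exact hd i _
    · refine ⟨Operand.gate (G.length + Fintype.equivFin κ x), fun ws => ?_, fun ds => ?_⟩
      · rw [(hB x).1 ws, Sum.elim_inr, hgval x _ ho0]
      · rw [Sum.elim_inr]
        exact (hB x).2 ds

/-- **One product layer.** Appending, for each `x : κ`, ONE product gate `∏_j v (src x j)` reading
members: cost `|κ| · |J|` wires, product depth `≤ D + 1`. [cite: Burgisser2000, Rem. 2.7] -/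
theorem JointPD.extend_prod {ι : Type w} {v : ι → MvPolynomial τ k} {δ : ι → ℕ} {s : ℕ}
    (h : JointPD v δ s) {κ : Type*} [Fintype κ] {J : Type*} [Fintype J]
    (src : κ → J → ι) (D : ℕ) (hD : ∀ x j, δ (src x j) ≤ D) :
    JointPD (Sum.elim v (fun x => ∏ j, v (src x j))) (Sum.elim δ (fun _ => D + 1))
      (s + Fintype.card κ * Fintype.card J) := by
  classical
  obtain ⟨G, hG, hmem⟩ := h
  choose o ho hd using hmem
  have ho0 : ∀ i, (o i).eval (gateValues G) = v i := fun i => by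
    simpa using ho i []
  set eJ := (Fintype.equivFin J).symm with heJ
  let gateOf : κ → Gate k τ := fun x =>
    Gate.prod (List.ofFn fun j : Fin (Fintype.card J) => o (src x (eJ j)))
  have hgval : ∀ x vals, (∀ i, (o i).eval vals = v i) →
      (gateOf x).eval vals = ∏ j, v (src x j) := by
    intro x vals hv
    simp only [gateOf, Gate.eval, List.map_ofFn, List.prod_ofFn, Function.comp_def, hv]
    exact Equiv.prod_comp eJ (fun j => v (src x j))
  have hval : ∀ x ws, (gateOf x).eval (gateValues G ++ ws) = (gateOf x).eval (gateValues G) := by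
    intro x ws
    rw [hgval x _ (fun i => ho i ws), hgval x _ ho0]
  have hdep : ∀ x ds, prodWeight (gateOf x) +
      (((gateOf x).args.map (Operand.depthIn (gateWDepths prodWeight G ++ ds))).foldr max 0) ≤ D + 1 := by
    intro x ds
    simp only [gateOf, prodWeight_prod, Gate.args, List.map_ofFn]
    rw [add_comm, Nat.add_le_add_iff_right]
    refine DepthReduction.foldr_max_le fun y hy => ?_
    rw [List.mem_ofFn] at hy
    obtain ⟨j, rfl⟩ := hy
    exact (hd _ ds).trans (hD _ _)
  have hB := block_members G gateOf (D + 1) hval hdep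
  refine ⟨G ++ List.ofFn (gateOf ∘ (Fintype.equivFin κ).symm), ?_, ?_⟩
  · rw [List.map_append, List.sum_append, List.map_ofFn, List.sum_ofFn]
    have : ∀ j : Fin (Fintype.card κ),
        (Gate.fanIn ∘ gateOf ∘ (Fintype.equivFin κ).symm) j = Fintype.card J := by
      intro j
      simp [gateOf, Gate.fanIn, Gate.args, List.length_ofFn]
    simp only [this, Finset.sum_const, Finset.card_univ, Fintype.card_fin, smul_eq_mul]
    omega
  · rintro (i | x)
    · refine ⟨o i, fun ws => ?_, fun ds => ?_⟩
      · rw [Sum.elim_inl, gateValues_append_of_stable G _ (fun g hg ws => ?_), List.append_assoc,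
          ho]
        rw [List.mem_ofFn] at hg
        obtain ⟨j, rfl⟩ := hg
        exact hval _ ws
      · obtain ⟨Ds, hDs, -, -⟩ := gateWDepths_append_le prodWeight G
          (List.ofFn (gateOf ∘ (Fintype.equivFin κ).symm)) (D + 1) (fun g hg ds => by
            rw [List.mem_ofFn] at hg
            obtain ⟨j, rfl⟩ := hg
            exact hdep _ ds)
        rw [Sum.elim_inl, hDs, List.append_assoc]
        exact hd i _
    · refine ⟨Operand.gate (G.length + Fintype.equivFin κ x), fun ws => ?_, fun ds => ?_⟩
      · rw [(hB x).1 ws, Sum.elim_inr, hgval x _ ho0]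
      · rw [Sum.elim_inr]
        exact (hB x).2 ds

end Toolkit

end Summit.ValiantsHypothesis.ValiantsHypothesis.Theorems.SuccinctLiftJointPD
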